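import Summits.AtomisticToContinuum.FouriersLaw.Theorems.OddSectorIrreversibilityWitnessGlueClosedFlow
import Literature.Probability.Moments.BrascampLiebVarianceViaPrekopaLeindler

/-!
# `SubBallisticWindow` (stmt-AtomisticToContinuum-14070), line `Sketch` — stub `stub_gibbsPoincare`

The `N`-uniform Poincaré (spectral gap) inequality for the unnormalised Gibbs weight
`μ = e^{-H/T} dq dp` of the pinned anharmonic chain `pinnedChain ω₂ lam β γ`
(`H(q,p) = Σ p_i²/2 + Σ U(q_i) + Σ_bonds V(q_{i+1} − q_i)`, `U(q) = ω₂ q²/2 + lam q⁴/4`,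
`V(r) = r²/2 + β r⁴/4`, `ω₂ > 0`, `lam, β ≥ 0`, `T > 0`): for `G ∈ C¹` with `G ∈ L²(μ)` and
`Σ_i ((∂_{q_i} G)² + (∂_{p_i} G)²) ∈ L¹(μ)`,

  `∫ (G − m)² dμ ≤ (T / min(ω₂, 1)) ∫ Σ_i ((∂_{q_i} G)² + (∂_{p_i} G)²) dμ`, `m = (∫ G dμ) / Z`.

Proof: `H` is `min(ω₂,1)`-uniformly convex in the first-order sense
(`H y ≥ H x + DH(x)(y − x) + (min(ω₂,1)/2) ‖y − x‖²`, proved termwise: `p²/2` is `1`-convex,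
`U(b) − U(a) − U'(a)(b − a) = ω₂ (b−a)²/2 + (lam/4)(b−a)²((a+b)² + 2a²)`, `V` is convex), and the
PROVED tree fact `Literature.Probability.Moments.BrascampLieb1976_thm41_uniform_holds`
(Brascamp–Lieb 1976, Thm 4.1, uniformly convex case, typed over `EuclideanSpace ℝ (Fin n)`) is
transferred along the volume-preserving linear coordinate map
`EuclideanSpace ℝ (Fin (N + N)) → PhaseSpace N`, `y ↦ ((y ∘ castAdd N), (y ∘ natAdd N))`, under
which `‖∇(G ∘ e)‖² = Σ_i ((∂_{q_i} G)² + (∂_{p_i} G)²)`.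
-/

noncomputable section

namespace Summit.AtomisticToContinuum.FouriersLaw.Theorems.SubBallisticWindow.GibbsPoincare

open MeasureTheory Filter Topology Set
open scoped NNReal ENNReal ContDiff RealInnerProductSpace
open Literature.MathematicalPhysics.KineticTheory.HeatConduction
open Summit.AtomisticToContinuum.FouriersLaw.Theorems

/-! ## First-order uniform convexity of the Hamiltonian -/

/-- The directional derivative of the chain Hamiltonian at `x = (q, p)` in the direction
`w = (a, b)`: `DH(x) w = Σ_i (p_i b_i + U'(q_i) a_i) + Σ_{j = i+1} V'(q_j − q_i) (a_j − a_i)`.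
[folklore] -/
theorem hasLineDerivAt_hamiltonian (P : OscillatorChain) (hU : Differentiable ℝ P.U)
    (hV : Differentiable ℝ P.V) (N : ℕ) (x w : PhaseSpace N) :
    HasLineDerivAt ℝ (P.hamiltonian N)
      ((∑ i, (x.2 i * w.2 i + deriv P.U (x.1 i) * w.1 i)) +
        ∑ i : Fin N, ∑ j : Fin N,
          if j.val = i.val + 1 then deriv P.V (x.1 j - x.1 i) * (w.1 j - w.1 i) else 0)
      x w := by
  unfold HasLineDerivAt
  have hfun : (fun t : ℝ => P.hamiltonian N (x + t • w)) = fun t =>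
      (∑ i, ((x.2 i + t * w.2 i) ^ 2 / 2 + P.U (x.1 i + t * w.1 i))) +
        ∑ i : Fin N, ∑ j : Fin N,
          if j.val = i.val + 1 then P.V ((x.1 j + t * w.1 j) - (x.1 i + t * w.1 i)) else 0 := by
    funext t
    simp only [OscillatorChain.hamiltonian, Prod.fst_add, Prod.snd_add, Prod.smul_fst,
      Prod.smul_snd, Pi.add_apply, Pi.smul_apply, smul_eq_mul]
  rw [hfun]
  have hlin : ∀ (a b : ℝ), HasDerivAt (fun t : ℝ => a + t * b) b 0 := fun a b =>
    (((hasDerivAt_id' (0 : ℝ)).mul_const b).const_add a).congr_deriv (one_mul b)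
  refine HasDerivAt.fun_add (HasDerivAt.fun_sum fun i _ => ?_)
    (HasDerivAt.fun_sum fun i _ => HasDerivAt.fun_sum fun j _ => ?_)
  · have hk : HasDerivAt (fun t : ℝ => (x.2 i + t * w.2 i) ^ 2 / 2) (x.2 i * w.2 i) 0 := by
      refine (((hlin (x.2 i) (w.2 i)).fun_pow 2).div_const 2).congr_deriv ?_
      simp only [zero_mul, add_zero, Nat.cast_ofNat]
      ring
    have hu : HasDerivAt (fun t : ℝ => P.U (x.1 i + t * w.1 i)) (deriv P.U (x.1 i) * w.1 i) 0 :=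
      (hU (x.1 i)).hasDerivAt.comp_of_eq 0 (hlin (x.1 i) (w.1 i)) (by simp)
    exact hk.fun_add hu
  · by_cases h : j.val = i.val + 1
    · simp only [h, if_true]
      have h3 : HasDerivAt (fun t : ℝ => (x.1 j + t * w.1 j) - (x.1 i + t * w.1 i))
          (w.1 j - w.1 i) 0 :=
        (hlin (x.1 j) (w.1 j)).fun_sub (hlin (x.1 i) (w.1 i))
      exact (hV _).hasDerivAt.comp_of_eq 0 h3 (by simp)
    · simp only [h, if_false]
      exact hasDerivAt_const _ _

/-- The pinning potential `U(q) = ω₂ q²/2 + lam q⁴/4` (`lam ≥ 0`) is `ω₂`-uniformly convex: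
`U(a) + U'(a)(b − a) + (ω₂/2)(b − a)² ≤ U(b)`
(`U(b) − U(a) − U'(a)(b−a) − ω₂(b−a)²/2 = (lam/4)(b−a)²((a+b)² + 2a²) ≥ 0`). [folklore] -/
theorem pinnedChain_U_convex (ω₂ lam β γ : ℝ) (hl : 0 ≤ lam) (a b : ℝ) :
    (pinnedChain ω₂ lam β γ).U a + deriv (pinnedChain ω₂ lam β γ).U a * (b - a) +
        ω₂ / 2 * (b - a) ^ 2 ≤ (pinnedChain ω₂ lam β γ).U b := by
  rw [pinnedChain_deriv_U]
  show ω₂ * a ^ 2 / 2 + lam * a ^ 4 / 4 + (ω₂ * a + lam * a ^ 3) * (b - a) +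
      ω₂ / 2 * (b - a) ^ 2 ≤ ω₂ * b ^ 2 / 2 + lam * b ^ 4 / 4
  have h : 0 ≤ lam * ((b - a) ^ 2 * ((a + b) ^ 2 + 2 * a ^ 2)) := by positivity
  nlinarith [h]

/-- The interaction potential `V(r) = r²/2 + β r⁴/4` (`β ≥ 0`) is convex:
`V(r) + V'(r)(s − r) ≤ V(s)`. [folklore] -/
theorem pinnedChain_V_convex (ω₂ lam β γ : ℝ) (hβ : 0 ≤ β) (r s : ℝ) :
    (pinnedChain ω₂ lam β γ).V r + deriv (pinnedChain ω₂ lam β γ).V r * (s - r) ≤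
      (pinnedChain ω₂ lam β γ).V s := by
  rw [pinnedChain_deriv_V]
  show r ^ 2 / 2 + β * r ^ 4 / 4 + (r + β * r ^ 3) * (s - r) ≤ s ^ 2 / 2 + β * s ^ 4 / 4
  have h : 0 ≤ β * ((s - r) ^ 2 * ((r + s) ^ 2 + 2 * r ^ 2)) := by positivity
  nlinarith [h, sq_nonneg (s - r)]

/-- **First-order uniform convexity of the pinned-chain Hamiltonian**: for `ω₂ > 0`,
`lam, β ≥ 0`, `H y ≥ H x + DH(x)(y − x) + (min(ω₂,1)/2) (Σ_i (Δq_i)² + Σ_i (Δp_i)²)`. [folklore] -/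
theorem pinnedChain_hamiltonian_convex (ω₂ lam β γ : ℝ) (hl : 0 ≤ lam) (hβ : 0 ≤ β)
    (N : ℕ) (x z : PhaseSpace N) :
    (pinnedChain ω₂ lam β γ).hamiltonian N x +
        fderiv ℝ ((pinnedChain ω₂ lam β γ).hamiltonian N) x (z - x) +
        min ω₂ 1 / 2 * ((∑ i, (z.1 i - x.1 i) ^ 2) + ∑ i, (z.2 i - x.2 i) ^ 2) ≤
      (pinnedChain ω₂ lam β γ).hamiltonian N z := by
  set P := pinnedChain ω₂ lam β γ with hP
  have hUd : Differentiable ℝ P.U :=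
    (pinnedChain_contDiff_U ω₂ lam β γ (n := 1)).differentiable one_ne_zero
  have hVd : Differentiable ℝ P.V :=
    (pinnedChain_contDiff_V ω₂ lam β γ (n := 1)).differentiable one_ne_zero
  have hHd : Differentiable ℝ (P.hamiltonian N) :=
    (pinnedChain_contDiff_hamiltonian ω₂ lam β γ N (n := 1)).differentiable one_ne_zero
  have hD := (hasLineDerivAt_hamiltonian P hUd hVd N x (z - x)).lineDeriv
  rw [(hHd x).lineDeriv_eq_fderiv] at hD
  rw [hD]
  have hκ1 : min ω₂ 1 ≤ 1 := min_le_right _ _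
  have hκω : min ω₂ 1 ≤ ω₂ := min_le_left _ _
  have hsite : ∀ i, (x.2 i ^ 2 / 2 + P.U (x.1 i)) +
      (x.2 i * (z - x).2 i + deriv P.U (x.1 i) * (z - x).1 i) +
      (min ω₂ 1 / 2 * (z.1 i - x.1 i) ^ 2 + min ω₂ 1 / 2 * (z.2 i - x.2 i) ^ 2) ≤
      z.2 i ^ 2 / 2 + P.U (z.1 i) := by
    intro i
    have hU := pinnedChain_U_convex ω₂ lam β γ hl (x.1 i) (z.1 i)
    simp only [Prod.fst_sub, Prod.snd_sub, Pi.sub_apply]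
    have hq : 0 ≤ (z.1 i - x.1 i) ^ 2 := sq_nonneg _
    have hp : 0 ≤ (z.2 i - x.2 i) ^ 2 := sq_nonneg _
    nlinarith [mul_le_mul_of_nonneg_right hκ1 hp, mul_le_mul_of_nonneg_right hκω hq]
  have hbond : ∀ i j : Fin N,
      (if j.val = i.val + 1 then P.V (x.1 j - x.1 i) else 0) +
        (if j.val = i.val + 1 then deriv P.V (x.1 j - x.1 i) * ((z - x).1 j - (z - x).1 i)
          else 0) ≤
      (if j.val = i.val + 1 then P.V (z.1 j - z.1 i) else 0) := by
    intro i j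
    by_cases h : j.val = i.val + 1
    · simp only [h, if_true, Prod.fst_sub, Pi.sub_apply]
      have hV := pinnedChain_V_convex ω₂ lam β γ hβ (x.1 j - x.1 i) (z.1 j - z.1 i)
      have e : z.1 j - x.1 j - (z.1 i - x.1 i) = (z.1 j - z.1 i) - (x.1 j - x.1 i) := by ring
      rw [e]
      exact hV
    · simp [h]
  have h1 := Finset.sum_le_sum fun i (_ : i ∈ Finset.univ) => hsite i
  have h2 := Finset.sum_le_sum fun i (_ : i ∈ Finset.univ) =>
    Finset.sum_le_sum fun j (_ : j ∈ Finset.univ) => hbond i j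
  simp only [Finset.sum_add_distrib, ← Finset.mul_sum] at h1 h2
  unfold OscillatorChain.hamiltonian
  simp only [Finset.sum_add_distrib]
  linarith

/-! ## The coordinate map `ℝ^{N+N} → PhaseSpace N`, `y ↦ (y ∘ castAdd N, y ∘ natAdd N)` -/

/-- The coordinate map `y ↦ (y ∘ castAdd N, y ∘ natAdd N)` from Euclidean `ℝ^{N+N}` onto phase
space preserves Lebesgue measure (it is `ofLp`, a reindexing, and `ℝ^{A ⊕ B} ≃ ℝ^A × ℝ^B`).
[folklore] -/
theorem measurePreserving_coords (N : ℕ) :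
    MeasurePreserving (fun y : EuclideanSpace ℝ (Fin (N + N)) =>
      ((fun i : Fin N => y (Fin.castAdd N i), fun i : Fin N => y (Fin.natAdd N i)) : PhaseSpace N))
      volume volume := by
  have hmp : MeasurePreserving
      ((MeasurableEquiv.toLp 2 (Fin (N + N) → ℝ)).symm.trans
        ((MeasurableEquiv.piCongrLeft (fun _ : Fin (N + N) => ℝ) finSumFinEquiv).symm.trans
          (MeasurableEquiv.sumPiEquivProdPi fun _ : Fin N ⊕ Fin N => ℝ)))
      (volume : Measure (EuclideanSpace ℝ (Fin (N + N)))) (volume : Measure (PhaseSpace N)) :=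
    ((EuclideanSpace.volume_preserving_symm_measurableEquiv_toLp (Fin (N + N))).trans
      (volume_measurePreserving_piCongrLeft (fun _ : Fin (N + N) => ℝ) finSumFinEquiv).symm).trans
      (volume_measurePreserving_sumPiEquivProdPi fun _ : Fin N ⊕ Fin N => ℝ)
  exact hmp

/-- The coordinate map is a measurable embedding (indeed a measurable equivalence). [folklore] -/
theorem measurableEmbedding_coords (N : ℕ) :
    MeasurableEmbedding (fun y : EuclideanSpace ℝ (Fin (N + N)) =>
      ((fun i : Fin N => y (Fin.castAdd N i), fun i : Fin N => y (Fin.natAdd N i)) : PhaseSpace N)) :=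
  ((MeasurableEquiv.toLp 2 (Fin (N + N) → ℝ)).symm.trans
    ((MeasurableEquiv.piCongrLeft (fun _ : Fin (N + N) => ℝ) finSumFinEquiv).symm.trans
      (MeasurableEquiv.sumPiEquivProdPi fun _ : Fin N ⊕ Fin N => ℝ))).measurableEmbedding

/-- Change of variables along the coordinate map: `∫ g ∘ e = ∫ g`. [folklore] -/
theorem integral_comp_coords (N : ℕ) (g : PhaseSpace N → ℝ) :
    ∫ y : EuclideanSpace ℝ (Fin (N + N)),
        g ((fun i : Fin N => y (Fin.castAdd N i)), fun i : Fin N => y (Fin.natAdd N i)) =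
      ∫ x, g x :=
  (measurePreserving_coords N).integral_comp (measurableEmbedding_coords N) g

/-- Integrability is invariant under the coordinate map. [folklore] -/
theorem integrable_comp_coords_iff (N : ℕ) (g : PhaseSpace N → ℝ) :
    Integrable (fun y : EuclideanSpace ℝ (Fin (N + N)) =>
        g ((fun i : Fin N => y (Fin.castAdd N i)), fun i : Fin N => y (Fin.natAdd N i))) ↔
      Integrable g :=
  (measurePreserving_coords N).integrable_comp_emb (measurableEmbedding_coords N)

/-- The coordinate map is linear, so it is smooth and composition preserves `C^n`. [folklore] -/
theorem contDiff_comp_coords (N : ℕ) {n : WithTop ℕ∞} {g : PhaseSpace N → ℝ}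
    (hg : ContDiff ℝ n g) :
    ContDiff ℝ n (fun y : EuclideanSpace ℝ (Fin (N + N)) =>
        g ((fun i : Fin N => y (Fin.castAdd N i)), fun i : Fin N => y (Fin.natAdd N i))) := by
  let L : EuclideanSpace ℝ (Fin (N + N)) →L[ℝ] PhaseSpace N :=
    (ContinuousLinearMap.pi fun i : Fin N => EuclideanSpace.proj (𝕜 := ℝ) (Fin.castAdd N i)).prod
      (ContinuousLinearMap.pi fun i : Fin N => EuclideanSpace.proj (𝕜 := ℝ) (Fin.natAdd N i))
  exact hg.comp L.contDiff

/-- Chain rule along the (linear) coordinate map: `D(g ∘ e)(y) v = Dg(e y) (e v)`. [folklore] -/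
theorem fderiv_comp_coords (N : ℕ) {g : PhaseSpace N → ℝ} (hg : Differentiable ℝ g)
    (y v : EuclideanSpace ℝ (Fin (N + N))) :
    fderiv ℝ (fun y : EuclideanSpace ℝ (Fin (N + N)) =>
        g ((fun i : Fin N => y (Fin.castAdd N i)), fun i : Fin N => y (Fin.natAdd N i))) y v =
      fderiv ℝ g ((fun i : Fin N => y (Fin.castAdd N i)), fun i : Fin N => y (Fin.natAdd N i))
        ((fun i : Fin N => v (Fin.castAdd N i)), fun i : Fin N => v (Fin.natAdd N i)) := by
  let L : EuclideanSpace ℝ (Fin (N + N)) →L[ℝ] PhaseSpace N :=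
    (ContinuousLinearMap.pi fun i : Fin N => EuclideanSpace.proj (𝕜 := ℝ) (Fin.castAdd N i)).prod
      (ContinuousLinearMap.pi fun i : Fin N => EuclideanSpace.proj (𝕜 := ℝ) (Fin.natAdd N i))
  have hL : (fun y : EuclideanSpace ℝ (Fin (N + N)) =>
      g ((fun i : Fin N => y (Fin.castAdd N i)), fun i : Fin N => y (Fin.natAdd N i))) = g ∘ ⇑L :=
    rfl
  rw [hL, fderiv_comp y (hg _) L.differentiableAt, L.fderiv]
  rfl

/-- In the orthonormal coordinates of `ℝ^{N+N}`, `‖∇(G ∘ e)(y)‖² = Σ_i ((∂_{q_i} G)² + (∂_{p_i} G)²)`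
at `e y`. [folklore] -/
theorem norm_gradient_sq_coords (N : ℕ) {G : PhaseSpace N → ℝ} (hG : Differentiable ℝ G)
    (y : EuclideanSpace ℝ (Fin (N + N))) :
    ‖gradient (fun y : EuclideanSpace ℝ (Fin (N + N)) =>
        G ((fun i : Fin N => y (Fin.castAdd N i)), fun i : Fin N => y (Fin.natAdd N i))) y‖ ^ 2 =
      ∑ i : Fin N,
        ((partialQ i G ((fun i : Fin N => y (Fin.castAdd N i)), fun i : Fin N => y (Fin.natAdd N i))) ^ 2 +
          (partialP i G ((fun i : Fin N => y (Fin.castAdd N i)), fun i : Fin N => y (Fin.natAdd N i))) ^ 2) := by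
  set f : EuclideanSpace ℝ (Fin (N + N)) → ℝ := fun y =>
    G ((fun i : Fin N => y (Fin.castAdd N i)), fun i : Fin N => y (Fin.natAdd N i)) with hf
  have hcoord : ∀ j, gradient f y j = fderiv ℝ f y (EuclideanSpace.single j 1) := fun j => by
    have h := EuclideanSpace.inner_single_right j (1 : ℝ) (gradient f y)
    rw [inner_gradient_left] at h
    simpa using h.symm
  have hQ : ∀ i : Fin N, fderiv ℝ f y (EuclideanSpace.single (Fin.castAdd N i) 1) =
      partialQ i G ((fun i : Fin N => y (Fin.castAdd N i)), fun i : Fin N => y (Fin.natAdd N i)) := by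
    intro i
    rw [hf, fderiv_comp_coords N hG, congrFun (partialQ_eq_fderiv hG i) _]
    congr 1
    refine Prod.ext (funext fun k => ?_) (funext fun k => ?_)
    · simp [Pi.single_apply, Fin.ext_iff]
    · have hi := i.2
      simp [Fin.ext_iff]
      omega
  have hP : ∀ i : Fin N, fderiv ℝ f y (EuclideanSpace.single (Fin.natAdd N i) 1) =
      partialP i G ((fun i : Fin N => y (Fin.castAdd N i)), fun i : Fin N => y (Fin.natAdd N i)) := by
    intro i
    rw [hf, fderiv_comp_coords N hG, congrFun (partialP_eq_fderiv hG i) _]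
    congr 1
    refine Prod.ext (funext fun k => ?_) (funext fun k => ?_)
    · have hk := k.2
      simp [Fin.ext_iff]
      omega
    · simp [Pi.single_apply, Fin.ext_iff]
  rw [EuclideanSpace.real_norm_sq_eq, Fin.sum_univ_add, ← Finset.sum_add_distrib]
  refine Finset.sum_congr rfl fun i _ => ?_
  rw [hcoord, hcoord, hQ, hP]

/-! ## The Gibbs weight `e^{-H/T} dq dp`: weighted-integral bookkeeping -/

/-- Integrals against the Gibbs weight `e^{-H/T} dq dp` are weighted Lebesgue integrals.
[folklore] -/
theorem integral_gibbsWeight_eq (ω₂ lam β γ : ℝ) (N : ℕ) (T : ℝ) (f : PhaseSpace N → ℝ) :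
    ∫ x, f x ∂(volume.withDensity fun x : PhaseSpace N => ENNReal.ofReal (Real.exp (-((pinnedChain ω₂ lam β γ).hamiltonian N x) / T))) =
      ∫ x, f x * Real.exp (-((pinnedChain ω₂ lam β γ).hamiltonian N x) / T) := by
  rw [integral_withDensity_eq_integral_toReal_smul
    (OddSectorWitness.measurable_gibbsDensity_ofReal (ω₂ := ω₂) (lam := lam) (β := β) γ N T)
    (Eventually.of_forall fun _ => ENNReal.ofReal_lt_top)]
  refine integral_congr_ae (Eventually.of_forall fun x => ?_)
  simp only [ENNReal.toReal_ofReal (Real.exp_pos _).le, smul_eq_mul]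
  ring

/-- Integrability against the Gibbs weight is Lebesgue integrability of `f e^{-H/T}`. [folklore] -/
theorem integrable_gibbsWeight_iff (ω₂ lam β γ : ℝ) (N : ℕ) (T : ℝ) (f : PhaseSpace N → ℝ) :
    Integrable f (volume.withDensity fun x : PhaseSpace N => ENNReal.ofReal (Real.exp (-((pinnedChain ω₂ lam β γ).hamiltonian N x) / T))) ↔
      Integrable fun x => f x * Real.exp (-((pinnedChain ω₂ lam β γ).hamiltonian N x) / T) := by
  rw [integrable_withDensity_iff_integrable_smul'
    (OddSectorWitness.measurable_gibbsDensity_ofReal (ω₂ := ω₂) (lam := lam) (β := β) γ N T)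
    (Eventually.of_forall fun _ => ENNReal.ofReal_lt_top)]
  refine integrable_congr (Eventually.of_forall fun x => ?_)
  simp only [ENNReal.toReal_ofReal (Real.exp_pos _).le, smul_eq_mul]
  ring

/-! ## The Poincaré inequality -/

/-- **stub_gibbsPoincare** (Brascamp–Lieb / Bakry–Émery Poincaré inequality for the Gibbs weight
of the pinned chain; `N`-uniform). For `ω₂ > 0`, `lam, β ≥ 0`, any `γ`, `T > 0`, every `N` and every
`G ∈ C¹(PhaseSpace N)` with `G ∈ L²(μ)`, `Σ_i ((∂_{q_i}G)² + (∂_{p_i}G)²) ∈ L¹(μ)`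
(`μ = e^{-H/T} dq dp`):
`∫ (G − m)² dμ ≤ (T / min(ω₂,1)) ∫ Σ_i ((∂_{q_i}G)² + (∂_{p_i}G)²) dμ`, `m = (∫ G dμ)/∫ e^{-H/T}`.
Proof: Brascamp–Lieb 1976 Thm 4.1 (uniformly convex case, the proved tree fact
`BrascampLieb1976_thm41_uniform_holds`) for `V = H∘e/T`, which is `(min(ω₂,1)/T)`-uniformly
convex (`pinnedChain_hamiltonian_convex`), transported along the volume-preserving coordinate
map `e : ℝ^{N+N} → PhaseSpace N` (`measurePreserving_coords`, `norm_gradient_sq_coords`).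
[folklore] -/
theorem stub_gibbsPoincare :
    ∀ ω₂ lam β γ : ℝ, 0 < ω₂ → 0 ≤ lam → 0 ≤ β → ∀ T : ℝ, 0 < T → ∀ (N : ℕ) (G : PhaseSpace N → ℝ),
      ContDiff ℝ 1 G →
      MemLp G 2 (volume.withDensity fun x : PhaseSpace N => ENNReal.ofReal (Real.exp (-((pinnedChain ω₂ lam β γ).hamiltonian N x) / T))) →
      Integrable (fun x : PhaseSpace N => ∑ i : Fin N, ((partialQ i G x) ^ 2 + (partialP i G x) ^ 2))
        (volume.withDensity fun x : PhaseSpace N => ENNReal.ofReal (Real.exp (-((pinnedChain ω₂ lam β γ).hamiltonian N x) / T))) →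
      ∫ x, (G x - (∫ y, G y ∂(volume.withDensity fun x : PhaseSpace N => ENNReal.ofReal (Real.exp (-((pinnedChain ω₂ lam β γ).hamiltonian N x) / T)))) /
          (∫ x : PhaseSpace N, Real.exp (-((pinnedChain ω₂ lam β γ).hamiltonian N x) / T))) ^ 2
        ∂(volume.withDensity fun x : PhaseSpace N => ENNReal.ofReal (Real.exp (-((pinnedChain ω₂ lam β γ).hamiltonian N x) / T))) ≤
        T / min ω₂ 1 * ∫ x, (∑ i : Fin N, ((partialQ i G x) ^ 2 + (partialP i G x) ^ 2))
          ∂(volume.withDensity fun x : PhaseSpace N => ENNReal.ofReal (Real.exp (-((pinnedChain ω₂ lam β γ).hamiltonian N x) / T))) := by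
  intro ω₂ lam β γ hω hl hβ T hT N G hG hG2 hI
  have hκ : 0 < min ω₂ 1 / T := div_pos (lt_min hω one_pos) hT
  have hGd : Differentiable ℝ G := hG.differentiable one_ne_zero
  have hHd : Differentiable ℝ ((pinnedChain ω₂ lam β γ).hamiltonian N) :=
    (pinnedChain_contDiff_hamiltonian ω₂ lam β γ N (n := 1)).differentiable one_ne_zero
  have hHe : Differentiable ℝ (fun y : EuclideanSpace ℝ (Fin (N + N)) => (pinnedChain ω₂ lam β γ).hamiltonian N ((fun i : Fin N => y (Fin.castAdd N i)), fun i : Fin N => y (Fin.natAdd N i))) :=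
    (contDiff_comp_coords N (pinnedChain_contDiff_hamiltonian ω₂ lam β γ N (n := 1))).differentiable
      one_ne_zero
  -- Lebesgue integrability of the weight, finiteness of `μ`, `μ`-integrability of `G`, `G²`
  have hρ : Integrable (fun x : PhaseSpace N => Real.exp (-((pinnedChain ω₂ lam β γ).hamiltonian N x) / T)) :=
    pinnedChain_integrable_gibbsDensity hω hl hβ γ N hT
  haveI hfin : IsFiniteMeasure (volume.withDensity fun x : PhaseSpace N => ENNReal.ofReal (Real.exp (-((pinnedChain ω₂ lam β γ).hamiltonian N x) / T))) :=
    isFiniteMeasure_withDensity_ofReal hρ.hasFiniteIntegral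
  have hG1 : Integrable G (volume.withDensity fun x : PhaseSpace N => ENNReal.ofReal (Real.exp (-((pinnedChain ω₂ lam β γ).hamiltonian N x) / T))) := hG2.integrable one_le_two
  have hGsq : Integrable (fun x => G x ^ 2) (volume.withDensity fun x : PhaseSpace N => ENNReal.ofReal (Real.exp (-((pinnedChain ω₂ lam β γ).hamiltonian N x) / T))) := hG2.integrable_sq
  -- exponent bookkeeping `-(T⁻¹ H) = -H/T`
  have hexp : ∀ x : PhaseSpace N, Real.exp (-(T⁻¹ * (pinnedChain ω₂ lam β γ).hamiltonian N x)) = Real.exp (-((pinnedChain ω₂ lam β γ).hamiltonian N x) / T) := by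
    intro x; congr 1; ring
  -- the hypotheses of Brascamp–Lieb for `V = T⁻¹ H ∘ e`, `f = G ∘ e`, `λ = min ω₂ 1 / T`
  have hV2 : ContDiff ℝ 2 (fun y : EuclideanSpace ℝ (Fin (N + N)) => T⁻¹ * (pinnedChain ω₂ lam β γ).hamiltonian N ((fun i : Fin N => y (Fin.castAdd N i)), fun i : Fin N => y (Fin.natAdd N i))) :=
    contDiff_const.mul (contDiff_comp_coords N (pinnedChain_contDiff_hamiltonian ω₂ lam β γ N))
  have hf1 : ContDiff ℝ 1 (fun y : EuclideanSpace ℝ (Fin (N + N)) => G ((fun i : Fin N => y (Fin.castAdd N i)), fun i : Fin N => y (Fin.natAdd N i))) :=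
    contDiff_comp_coords N hG
  have hconv : ∀ y z : EuclideanSpace ℝ (Fin (N + N)),
      T⁻¹ * (pinnedChain ω₂ lam β γ).hamiltonian N ((fun i : Fin N => y (Fin.castAdd N i)), fun i : Fin N => y (Fin.natAdd N i)) +
        ⟪gradient (fun y : EuclideanSpace ℝ (Fin (N + N)) => T⁻¹ * (pinnedChain ω₂ lam β γ).hamiltonian N ((fun i : Fin N => y (Fin.castAdd N i)), fun i : Fin N => y (Fin.natAdd N i))) y, z - y⟫ +
        min ω₂ 1 / T / 2 * ‖z - y‖ ^ 2 ≤ T⁻¹ * (pinnedChain ω₂ lam β γ).hamiltonian N ((fun i : Fin N => z (Fin.castAdd N i)), fun i : Fin N => z (Fin.natAdd N i)) := by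
    intro y z
    rw [inner_gradient_left, fderiv_const_mul (hHe y) T⁻¹, FunLike.coe_smul, Pi.smul_apply,
      fderiv_comp_coords N hHd, smul_eq_mul]
    have hsub : (((fun i : Fin N => (z - y) (Fin.castAdd N i)), fun i : Fin N => (z - y) (Fin.natAdd N i)) : PhaseSpace N) = ((fun i : Fin N => z (Fin.castAdd N i)), fun i : Fin N => z (Fin.natAdd N i)) - ((fun i : Fin N => y (Fin.castAdd N i)), fun i : Fin N => y (Fin.natAdd N i)) := by
      refine Prod.ext (funext fun i => ?_) (funext fun i => ?_) <;> simp
    have hnorm : ‖z - y‖ ^ 2 = (∑ i : Fin N, (z (Fin.castAdd N i) - y (Fin.castAdd N i)) ^ 2) +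
        ∑ i : Fin N, (z (Fin.natAdd N i) - y (Fin.natAdd N i)) ^ 2 := by
      rw [EuclideanSpace.real_norm_sq_eq, Fin.sum_univ_add]
      simp
    rw [hsub, hnorm]
    have hc := pinnedChain_hamiltonian_convex ω₂ lam β γ hl hβ N ((fun i : Fin N => y (Fin.castAdd N i)), fun i : Fin N => y (Fin.natAdd N i)) ((fun i : Fin N => z (Fin.castAdd N i)), fun i : Fin N => z (Fin.natAdd N i))
    dsimp only at hc
    have hT' : 0 ≤ T⁻¹ := (inv_pos.mpr hT).le
    have hc' := mul_le_mul_of_nonneg_left hc hT'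
    have e1 : min ω₂ 1 / T / 2 = T⁻¹ * (min ω₂ 1 / 2) := by ring
    rw [e1]
    linarith
  have hZ : Integrable (fun y : EuclideanSpace ℝ (Fin (N + N)) =>
      Real.exp (-(T⁻¹ * (pinnedChain ω₂ lam β γ).hamiltonian N ((fun i : Fin N => y (Fin.castAdd N i)), fun i : Fin N => y (Fin.natAdd N i))))) := by
    simp_rw [hexp]
    exact (integrable_comp_coords_iff N (fun x => Real.exp (-((pinnedChain ω₂ lam β γ).hamiltonian N x) / T))).mpr hρ
  have h1 : Integrable (fun y : EuclideanSpace ℝ (Fin (N + N)) =>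
      G ((fun i : Fin N => y (Fin.castAdd N i)), fun i : Fin N => y (Fin.natAdd N i)) * Real.exp (-(T⁻¹ * (pinnedChain ω₂ lam β γ).hamiltonian N ((fun i : Fin N => y (Fin.castAdd N i)), fun i : Fin N => y (Fin.natAdd N i))))) := by
    simp_rw [hexp]
    exact (integrable_comp_coords_iff N (fun x => G x * Real.exp (-((pinnedChain ω₂ lam β γ).hamiltonian N x) / T))).mpr
      ((integrable_gibbsWeight_iff ω₂ lam β γ N T G).mp hG1)
  have h2 : Integrable (fun y : EuclideanSpace ℝ (Fin (N + N)) =>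
      G ((fun i : Fin N => y (Fin.castAdd N i)), fun i : Fin N => y (Fin.natAdd N i)) ^ 2 * Real.exp (-(T⁻¹ * (pinnedChain ω₂ lam β γ).hamiltonian N ((fun i : Fin N => y (Fin.castAdd N i)), fun i : Fin N => y (Fin.natAdd N i))))) := by
    simp_rw [hexp]
    exact (integrable_comp_coords_iff N (fun x => G x ^ 2 * Real.exp (-((pinnedChain ω₂ lam β γ).hamiltonian N x) / T))).mpr
      ((integrable_gibbsWeight_iff ω₂ lam β γ N T (fun x => G x ^ 2)).mp hGsq)
  have h3 : Integrable (fun y : EuclideanSpace ℝ (Fin (N + N)) =>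
      ‖gradient (fun y : EuclideanSpace ℝ (Fin (N + N)) => G ((fun i : Fin N => y (Fin.castAdd N i)), fun i : Fin N => y (Fin.natAdd N i))) y‖ ^ 2 *
        Real.exp (-(T⁻¹ * (pinnedChain ω₂ lam β γ).hamiltonian N ((fun i : Fin N => y (Fin.castAdd N i)), fun i : Fin N => y (Fin.natAdd N i))))) := by
    simp_rw [hexp, norm_gradient_sq_coords N hGd]
    exact (integrable_comp_coords_iff N (fun x =>
      (∑ i : Fin N, ((partialQ i G x) ^ 2 + (partialP i G x) ^ 2)) * Real.exp (-((pinnedChain ω₂ lam β γ).hamiltonian N x) / T))).mpr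
      ((integrable_gibbsWeight_iff ω₂ lam β γ N T _).mp hI)
  -- Brascamp–Lieb on `ℝ^{N+N}`
  have key := Literature.Probability.Moments.BrascampLieb1976_thm41_uniform_holds (N + N)
    (fun y : EuclideanSpace ℝ (Fin (N + N)) => T⁻¹ * (pinnedChain ω₂ lam β γ).hamiltonian N ((fun i : Fin N => y (Fin.castAdd N i)), fun i : Fin N => y (Fin.natAdd N i)))
    (fun y : EuclideanSpace ℝ (Fin (N + N)) => G ((fun i : Fin N => y (Fin.castAdd N i)), fun i : Fin N => y (Fin.natAdd N i))) (min ω₂ 1 / T) hκ hV2 hf1 hconv hZ h1 h2 h3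
  dsimp only at key
  simp only [hexp, norm_gradient_sq_coords N hGd] at key
  -- back to phase space
  have i0 := integral_comp_coords N (fun x => Real.exp (-((pinnedChain ω₂ lam β γ).hamiltonian N x) / T))
  have i1 := integral_comp_coords N (fun x => G x * Real.exp (-((pinnedChain ω₂ lam β γ).hamiltonian N x) / T))
  have i3 := integral_comp_coords N (fun x =>
    (∑ i : Fin N, ((partialQ i G x) ^ 2 + (partialP i G x) ^ 2)) * Real.exp (-((pinnedChain ω₂ lam β γ).hamiltonian N x) / T))
  dsimp only at i0 i1 i3
  rw [i0, i1, i3] at key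
  have i2 := integral_comp_coords N (fun x =>
    (G x - (∫ x, G x * Real.exp (-((pinnedChain ω₂ lam β γ).hamiltonian N x) / T)) / ∫ x : PhaseSpace N, Real.exp (-((pinnedChain ω₂ lam β γ).hamiltonian N x) / T)) ^ 2 *
      Real.exp (-((pinnedChain ω₂ lam β γ).hamiltonian N x) / T))
  dsimp only at i2
  rw [i2, inv_div] at key
  rw [integral_gibbsWeight_eq, integral_gibbsWeight_eq, integral_gibbsWeight_eq]
  exact key

end Summit.AtomisticToContinuum.FouriersLaw.Theorems.SubBallisticWindow.GibbsPoincare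

end
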